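import Summits.QuantumFields.BalabanUV.T4Continuum.Spine.NE5.TwoRunTorusNE5Uniform
import Summits.QuantumFields.BalabanUV.T4Continuum.Spine.NE5.TwoRunTorusNE5Sizes
import Summits.QuantumFields.BalabanUV.T4Continuum.Spine.NE5.TwoRunTorusNE5Late

/-!
# Spine/NE5/TwoRunTorusNE5Final — the minimal END of row NE5 in the producer's order, package sizes exported, and the
# two-run pencil record asked at the WINDOW scales only (cell `pub-balaban-gaps`, seat `ne5` gen 14; (x15)∕(x16)∕(x17)∕(x17′))

WHY.  `TwoRunTorusNE5Sized.ne5_end_sized` (T47) still asks the pencil record at EVERY scale, hence (T46: `R_j ≥ 2C_R`) an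
absolute two-run closeness `r_j ≤ s₀∕(2C_R)` already at `j = 0`, where print has only a rate (King p. 665, «L^{−γk}»)
— located point (x17′).  `TwoRunTorusNE5Late.ne5_of_records_symm_late` (T48) removes the early-scale demand from T39: at
scales `θ^j ≥ s` only the two members' one-run bounds are read.  THIS FILE, `ne5_end_final`: T47 rebuilt on T48 —
`∃ c ∀ (ν, Nf, letters) ∃ (C_R > 2, C_σ, γ₂, a₂₀, w₀) ∀ (θ, s, R_σ0, M) ∃ (w, α, r_P)`, sizes `α j = max 2 (s∕θ^j)`,
`(w j).R = max 2 (s∕θ^j)·C_R`, `(w j).Rσ = max R_σ0 C_σ`, then T43's ∀-part with every record-reading hypothesis GUARDED by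
`θ ^ j < s` and the two members' one-run bounds `‖E j b X φ‖ ≤ A₂C₃ε₁·e^{−(1−10δ)½Lκ·d_j X}` (`b = 0, 1`, every scale — each
run's own printed Lemma 3 ∕ (2.41)) → `NE5 … ((1−10δ)½Lκ) θ (2A₂C₃ε₁∕s)`.  The junction with NODE O ∕ rows NE2–NE3 is then
ONE RATE inequality: with two-run closeness `r_j ≤ C₂θ^j` and Neumann reach `s₀` (T42) the producer meets the END by
taking the margin `s ≤ s₀∕(2C₂C_R)` (then `r_j·R_j ≤ s₀` at every window scale) and `M` with `⅔M ≥ max R_σ0 C_σ`; nothing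
two-run is asked where `θ^j ≥ s`.

HONEST FRAMING.  Quantifier bookkeeping over landed shapes; nothing of Bałaban's is constructed or asserted beyond print.
NE5 NOT PRINTED ∕ NOT PROVED; leaves 0∕12; (D4) 0∕1; spine 0∕9.  Rung (B)+1 on a FIXED finite T⁴ — NOT continuum, NOT
infinite volume, NOT mass gap, NOT Clay.  HONEST DEPENDENCY: continuum YM on T⁴ ⇐ BetaPertH ∧ nine spine estimates;
BetaPertH ⇐ (D1) ∧ (D4) ∧ CAP+tail.  0 sorry, 0 `def`.

Sources: [II] = T. Bałaban, CMP **116** (1988) [Balaban1988RG2Cluster] p. 13, p. 15, (2.13)–(2.26) pp. 14–17, (2.18) p. 16,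
(2.31) p. 18, (2.38) p. 20, p. 21; [I] = CMP **109** (1987) [Balaban1987RG1] (0.24)–(0.25) p. 257; [B9] = CMP **99** (1985)
[Balaban1985BackgroundPropagators] Thm 3.7 p. 409, Thm 3.10 (3.107)–(3.108) p. 416.  Nothing here is a claim about the
Yang–Mills mass gap.
-/

noncomputable section

namespace Summit.QuantumFields.BalabanUV.T4Continuum.Spine.NE5.TwoRunTorusNE5Final

open Matrix Metric Set Finset
open Literature.MathematicalPhysics.QuantumFieldTheory.Balaban1983to89
open Literature.MathematicalPhysics.QuantumFieldTheory.Balaban1983to89.T4OutputRate (NE5)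
open Literature.MathematicalPhysics.QuantumFieldTheory.Balaban1983to89.TreeLengthTorus (TPt TDom tsys)
open Literature.MathematicalPhysics.QuantumFieldTheory.Balaban1983to89.TreeLengthTorusGeometry (TTouch)
open Literature.MathematicalPhysics.QuantumFieldTheory.Balaban1983to89.TreeLengthTorusTransfer (tclosure)
open Literature.MathematicalPhysics.QuantumFieldTheory.Balaban1983to89.B13Lemma3TorusData (TBond)
open Literature.MathematicalPhysics.QuantumFieldTheory.Balaban1983to89.B13Lemma3Torus (TwoTorusStep)
open Literature.MathematicalPhysics.QuantumFieldTheory.Balaban1983to89.B13Lemma3TorusTerms (terms weight Z0)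
open Literature.MathematicalPhysics.QuantumFieldTheory.Balaban1983to89.B13Term214 (core214 F214 term214)
open Literature.MathematicalPhysics.QuantumFieldTheory.Balaban1983to89.B13Bound143 (invTau)
open Literature.MathematicalPhysics.QuantumFieldTheory.Balaban1983to89.B5TorusCover (UT)
open Literature.MathematicalPhysics.QuantumFieldTheory.Balaban1983to89.B12TreeDecay (kappa₀ K₀)
open Literature.MathematicalPhysics.QuantumFieldTheory.Balaban1983to89.B13Resummation (locE)
open Literature.MathematicalPhysics.QuantumFieldTheory.Balaban1983to89.B13TermWalkData
  (WalkConsts TermKernels TermWalkData)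
open Summit.QuantumFields.BalabanUV.T4Continuum.Spine.NE5.TwoRunTorusNE5Late (ne5_of_records_symm_late)
open Summit.QuantumFields.BalabanUV.T4Continuum.Spine.NE5.TwoRunTorusNE5Sizes (scalars_sized)
open Summit.QuantumFields.BalabanUV.T4Continuum.Spine.NE5.TwoRunTorusNE5 (torusCarriers reFunctional)
open Summit.QuantumFields.BalabanUV.T4Continuum.Spine.NE5.TwoRunTorusNE5Uniform (lemma3_witness_allM)

open Classical in
/-- **THE END — producer's order, sizes exported, pencil records at the window scales only.**  There is ONE constants
record `c` (8 ≤ c.L, 1 ≤ c.κ₁, (2.18)) such that for all fibre data and O(1) letters there are size constants `C_R > 2`,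
`C_σ` and `γ₂ > 0, a₂₀ ≥ 0, w₀ > 0` such that for all rates `θ, s > 0`, floors `R_σ0` and bond-cube sides `M ≥ 1` there
are packages `w j`, sizes `α j = max 2 (s∕θ^j)` and `r_P` with `(w j).R = max 2 (s∕θ^j)·C_R`, `(w j).Rσ = max R_σ0 C_σ`,
the letters of `w j` the given ones, such that: for every family of torus models, τ-regions, contour radius, parameter
lists, record DATA `𝒦 j` (any, at every scale) whose walk-record ∕ σ-holomorphy ∕ symmetry ∕ (2.20) ∕ fibre ∕ size ∕
(2.14)-summation ∕ (2.13) PROPERTIES are asked ONLY AT THE WINDOW SCALES `θ^j < s`, `χ` with (2.22), and outputs `E j b`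
whose members `E j 0`, `E j 1` obey the one-run bound `A₂C₃ε₁·e^{−(1−10δ)½Lκ·d_j X}` at EVERY scale —
`NE5 (torus carriers) (E·0) (E·1) W′ ((1−10δ)½Lκ) θ (2A₂C₃ε₁∕s)` BY NAME.  Proof: T48 fed by T46 `scalars_sized` and T45
`lemma3_witness_allM`.  This is the form in which NODE O (records at its own `M`, letters, radius `min(R, s₀∕r_j)`,
σ-distance `⅔M`) and rows NE2∕NE3 (the rate `r_j ≤ C₂θ^j`) are asked — located points (x15)–(x17′) all closed NE5-side.
[cite: Balaban1987RG1, (0.24)–(0.25) p.257; Balaban1988RG2Cluster, p.13, p.15, (2.13)–(2.26) pp.14–17, (2.18) p.16, (2.31) p.18, (2.38) p.20, (2.41) p.21; Balaban1985BackgroundPropagators, Thm 3.7 p.409, Thm 3.10 (3.107)–(3.108) p.416; King1986, p.665] -/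
theorem ne5_end_final :
    ∃ c : B13.Consts, 8 ≤ c.L ∧ 1 ≤ c.κ₁ ∧ (∀ d : ℝ, 0 ≤ d → 0 < invTau c d ∧ invTau c d ≤ 1 / 2) ∧
      ∀ {ν : ℕ} {Nf : ℕ → Fin ν → ℕ} [∀ j i, NeZero (Nf j i)],
      ∀ {KΓ KE KC ε κ : ℝ}, 0 ≤ KΓ → 0 ≤ KE → 0 ≤ KC → 0 < ε → 0 < κ → ∀ (m : ℕ) {nΛ nN : ℝ}, 0 ≤ nΛ → 0 ≤ nN →
      ∃ (CR Cσ γ₂ a₂₀ w₀ : ℝ), 2 < CR ∧ 0 < γ₂ ∧ 0 ≤ a₂₀ ∧ 0 < w₀ ∧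
      ∀ {θ s : ℝ}, 0 < θ → 0 < s → ∀ (Rσ₀ : ℝ) (M : ℕ) [NeZero M],
      ∃ (w : ℕ → WalkConsts) (α : ℕ → ℝ) (rP : ℝ),
      (∀ j, (w j).Admissible (α j) Rσ₀) ∧ (∀ j, 1 < α j) ∧ (∀ j, θ ^ j < s → s / θ ^ j ≤ α j) ∧
      (∀ j, (w j).KbarΓ = KΓ ∧ (w j).KbarE = KE ∧ (w j).KbarC = KC ∧ (w j).kap = κ ∧ (w j).ε = ε) ∧
      (∀ j, α j = max 2 (s / θ ^ j)) ∧ (∀ j, (w j).R = max 2 (s / θ ^ j) * CR) ∧ (∀ j, (w j).Rσ = max Rσ₀ Cσ) ∧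
      ∀ {L : ℕ} [NeZero L], c.L = L → ∀ (N : ℕ → ℕ) [∀ j, NeZero (N j)] (W : (j : ℕ) → TwoTorusStep 4 L (N j))
        {Uτ : (j : ℕ) → TDom 4 (L * N j) → Set ℂ}, (∀ j Y, IsOpen (Uτ j Y)) →
        (∀ j, ∀ Y : TDom 4 (L * N j), closedBall (0 : ℂ) ((invTau c ((tsys 4 (L * N j)).dj Y))⁻¹) ⊆ Uτ j Y) →
        ∀ {r : ℝ}, 0 < r → r ≤ Real.exp c.κ₁ - 1 → (∀ j Y, ∀ ζ ∈ Set.uIcc (0 : ℝ) 1, closedBall (ζ : ℂ) r ⊆ Uτ j Y) →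
        ∀ (lZ : (j : ℕ) → TDom 4 (N j) → Finset (TDom 4 (L * N j)) × Finset (TBond 4 M (L * N j)) → List (TPt 4 (N j))),
        (∀ j Z t, (lZ j Z t).Nodup ∧ (lZ j Z t).toFinset = Z.1 \ tclosure L (N j) (Z0 M t)) →
        ∀ (lD : (j : ℕ) → Finset (TDom 4 (L * N j)) × Finset (TBond 4 M (L * N j)) → List (TDom 4 (L * N j))),
        (∀ j t, (lD j t).Nodup ∧ (lD j t).toFinset = t.1) →
        ∀ (𝒦 : (j : ℕ) → (Z : TDom 4 (N j)) → Finset (TDom 4 (L * N j)) × Finset (TBond 4 M (L * N j)) → (W j).Φ →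
            TermKernels ({ c with κ₁ := c.κ₁ + 1 } : B13.Consts) 4 (N j) ν (Nf j) ℂ)
          [∀ j Z t φ, Fintype (𝒦 j Z t φ).C₀] [∀ j Z t φ, DecidableEq (𝒦 j Z t φ).C₀],
        (∀ j, θ ^ j < s → ∀ Z, ∀ t ∈ terms L M Z, ∀ φ, φ ∈ (W j).sp2 Z → TermWalkData (𝒦 j Z t φ) (w j)) →
        ∀ (Γ : (j : ℕ) → (Z : TDom 4 (N j)) → (t : Finset (TDom 4 (L * N j)) × Finset (TBond 4 M (L * N j))) →
            (φ : (W j).Φ) → ℂ → (TPt 4 (N j) → ℂ) → ((𝒦 j Z t φ).Λ ⊕ (𝒦 j Z t φ).C₀ → ℝ) → ((𝒦 j Z t φ).Λ → ℂ)),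
        (∀ j, θ ^ j < s → ∀ Z, ∀ t ∈ terms L M Z, ∀ φ, φ ∈ (W j).sp2 Z → ∀ b ∈ ball (0 : ℂ) (α j),
          ∀ σ : TPt 4 (N j) → ℂ, (∀ i, σ i ∈ ball (0 : ℂ) (Real.exp (c.κ₁ + 1))) →
            ∀ X : (𝒦 j Z t φ).Λ ⊕ (𝒦 j Z t φ).C₀ → ℝ, Γ j Z t φ b σ X = (𝒦 j Z t φ).G2 σ b *ᵥ fun i => (X i : ℂ)) →
        ∀ (χY₀ χcP : (j : ℕ) → (Z : TDom 4 (N j)) → (t : Finset (TDom 4 (L * N j)) × Finset (TBond 4 M (L * N j))) →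
            (φ : (W j).Φ) → ((𝒦 j Z t φ).Λ → ℝ) → ℝ),
        (∀ j Z t φ Bf, 0 ≤ χY₀ j Z t φ Bf) → (∀ j Z t φ Bf, 0 ≤ χcP j Z t φ Bf) →
        ∀ (Dfam : (j : ℕ) → TDom 4 (N j) → Finset (TDom 4 (L * N j)) × Finset (TBond 4 M (L * N j)) →
            Finset (TDom 4 (L * N j)))
          (Vk : (j : ℕ) → (Z : TDom 4 (N j)) → (t : Finset (TDom 4 (L * N j)) × Finset (TBond 4 M (L * N j))) →
            (φ : (W j).Φ) → ℂ → TDom 4 (L * N j) → ((𝒦 j Z t φ).Λ → ℝ) → ℂ),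
        (∀ j, θ ^ j < s → ∀ Z, ∀ t ∈ terms L M Z, ∀ φ, φ ∈ (W j).sp2 Z → ∀ b ∈ ball (0 : ℂ) (α j), ∀ i i',
          DifferentiableOn ℂ (fun σ => (𝒦 j Z t φ).A2 σ b i i') {σ | ∀ i, σ i ∈ ball (0 : ℂ) (Real.exp (c.κ₁ + 1))}) →
        (∀ j, θ ^ j < s → ∀ Z, ∀ t ∈ terms L M Z, ∀ φ, φ ∈ (W j).sp2 Z → ∀ b ∈ ball (0 : ℂ) (α j), ∀ i i',
          DifferentiableOn ℂ (fun σ => (𝒦 j Z t φ).G2 σ b i i') {σ | ∀ i, σ i ∈ ball (0 : ℂ) (Real.exp (c.κ₁ + 1))}) →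
        (∀ j, θ ^ j < s → ∀ Z, ∀ t ∈ terms L M Z, ∀ φ, φ ∈ (W j).sp2 Z → ∀ Y Bf,
          DifferentiableOn ℂ (fun b => Vk j Z t φ b Y Bf) (ball (0 : ℂ) (α j))) →
        (∀ j Z t φ, Measurable (χY₀ j Z t φ)) → (∀ j Z t φ, Measurable (χcP j Z t φ)) →
        (∀ j, θ ^ j < s → ∀ Z, ∀ t ∈ terms L M Z, ∀ φ, φ ∈ (W j).sp2 Z → ∀ b ∈ ball (0 : ℂ) (α j), ∀ Y,
          Measurable (Vk j Z t φ b Y)) →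
        (∀ j, θ ^ j < s → ∀ Z, ∀ t ∈ terms L M Z, ∀ φ, φ ∈ (W j).sp2 Z → ∀ b : ℂ, ‖b‖ ≤ α j →
          ∀ σ : TPt 4 (N j) → ℂ, (∀ i, ‖σ i‖ ≤ Real.exp (c.κ₁ + 1)) → ((𝒦 j Z t φ).A2 σ b).IsSymm) →
        ∀ {w₂₀ : ℝ} (qP : (j : ℕ) → (Z : TDom 4 (N j)) → (t : Finset (TDom 4 (L * N j)) × Finset (TBond 4 M (L * N j))) →
            (φ : (W j).Φ) → ((𝒦 j Z t φ).Λ → ℝ) → ℝ),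
        (∀ j Z t φ Bf, χY₀ j Z t φ Bf * χcP j Z t φ Bf ≤
          Real.exp (-(γ₂ / 2 * rP ^ 2 * (t.2.card : ℕ)) + γ₂ / 2 * qP j Z t φ Bf)) →
        (∀ j Z t φ Bf, qP j Z t φ Bf ≤ Bf ⬝ᵥ Bf) →
        (∀ j, θ ^ j < s → ∀ Z, ∀ t ∈ terms L M Z, ∀ φ, φ ∈ (W j).sp2 Z → ∀ b ∈ ball (0 : ℂ) (α j),
          ∀ τ : TDom 4 (L * N j) → ℂ, (∀ Y, τ Y ∈ Uτ j Y) →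
            ∀ Bf, ∑ Y ∈ Dfam j Z t, ‖τ Y‖ * ‖Vk j Z t φ b Y Bf‖ ≤ a₂₀ / 2 * (Bf ⬝ᵥ Bf) + w₂₀) →
        (∀ j, ∀ Z : TDom 4 (N j), w₂₀ ≤ w₀ * ((Z.1).card : ℝ)) →
        (∀ j, θ ^ j < s → ∀ Z t φ, (𝒦 j Z t φ).m ≤ m) →
        (∀ j, θ ^ j < s → ∀ Z t φ, ∀ x : UT (Nf j), (Finset.univ.filter fun i => (𝒦 j Z t φ).locN i = x).card ≤ m) →
        (∀ j, θ ^ j < s → ∀ Z t φ, (Fintype.card (𝒦 j Z t φ).Λ : ℝ) ≤ nΛ * ((Z.1).card : ℝ)) →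
        (∀ j, θ ^ j < s → ∀ Z t φ, (Fintype.card ((𝒦 j Z t φ).Λ ⊕ (𝒦 j Z t φ).C₀) : ℝ) ≤ nN * ((Z.1).card : ℝ)) →
        ∀ {H : (j : ℕ) → ℂ → TDom 4 (N j) → (W j).Φ → ℂ},
        (∀ j, θ ^ j < s → ∀ b ∈ ball (0 : ℂ) (α j), ∀ (Z : TDom 4 (N j)) (φ : (W j).Φ), φ ∈ (W j).sp2 Z →
          H j b Z φ = ∑ t ∈ terms L M Z,
            term214 r (lZ j Z t) (lD j t) (core214 (fun σ => (𝒦 j Z t φ).A2 σ b) (Γ j Z t φ b)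
              (F214 t.2.card (χY₀ j Z t φ) (χcP j Z t φ) (Dfam j Z t) (Vk j Z t φ b))) 0 0) →
        (∀ j, ∀ X Z : TDom 4 (N j), ∀ φ, Z.1 ⊆ X.1 → φ ∈ (W j).sp2 X → φ ∈ (W j).sp2 Z) →
        ∀ {E : (j : ℕ) → ℂ → TDom 4 (N j) → (W j).Φ → ℂ},
        (∀ j, θ ^ j < s → ∀ b ∈ ball (0 : ℂ) (α j), ∀ (X : TDom 4 (N j)) (φ : (W j).Φ), φ ∈ (W j).sp2 X →
          E j b X φ = locE (TTouch (d := 4) (N := N j)) (fun Z : TDom 4 (N j) => Z.1) (fun Z => H j b Z φ) X.1) →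
        (∀ j (X : TDom 4 (N j)) (φ : (W j).Φ), φ ∈ (W j).sp2 X → ‖E j 0 X φ‖ ≤
          c.A₂ * c.C3act * c.ε₁ * Real.exp (-((1 - 10 * c.δ) * ((c.L : ℝ) / 2) * c.κ * (tsys 4 (N j)).dj X))) →
        (∀ j (X : TDom 4 (N j)) (φ : (W j).Φ), φ ∈ (W j).sp2 X → ‖E j 1 X φ‖ ≤
          c.A₂ * c.C3act * c.ε₁ * Real.exp (-((1 - 10 * c.δ) * ((c.L : ℝ) / 2) * c.κ * (tsys 4 (N j)).dj X))) →
        ∀ W' : Set (ℕ → ℝ),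
        NE5 (C := torusCarriers N W) (reFunctional N W fun j => E j 0) (reFunctional N W fun j => E j 1) W'
          ((1 - 10 * c.δ) * ((c.L : ℝ) / 2) * c.κ) θ (2 * (c.A₂ * c.C3act * c.ε₁) / s) := by
  obtain ⟨c, a₂, a₂', a₅, Aabs, Bc, hc⟩ := lemma3_witness_allM
  -- the clauses on `c` alone and `0 < a₅`, read at `M = 1`
  obtain ⟨-, hL, -, -, -, -, -, -, -, -, -, -, -, -, -, -, -, -, -, -, -, -, -, -, -, -, -,
    -, -, -, -, -, -, -, -, -, -, -, -, ha₅, hκ₁, hτ⟩ := hc 1 Nat.one_pos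
  refine ⟨c, hL, hκ₁, hτ, ?_⟩
  intro ν Nf _ KΓ KE KC ε κ hKΓ hKE hKC hε hκ m nΛ nN hnΛ hnN
  -- T46 §2: the scale-free letters and the two size constants, from the O(1) letters and `a₅` alone
  have hκa : 4 * κ / 5 < κ := by linarith
  have hκb : 3 * κ / 5 < 4 * κ / 5 := by linarith
  have h2 : 2 * κ / 5 < 3 * κ / 5 := by linarith
  have h1 : κ / 5 < 2 * κ / 5 := by linarith
  have h0 : 0 < κ / 5 := by linarith
  obtain ⟨ϑ, cE, g, γ₂, a₂₀, w₀, CR, Cσ, -, -, -, hγ₂, ha₂₀, hw₀, hCR, hαc, hsmallG, hsz⟩ :=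
    scalars_sized hKΓ hKE hKC hε hκ (Nat.cast_nonneg m) ν hκa hκb h2 h1 h0 hnΛ hnN ha₅
  refine ⟨CR, Cσ, γ₂, a₂₀, w₀, hCR, hγ₂, ha₂₀, hw₀, ?_⟩
  intro θ s hθ hs Rσ₀ M _
  obtain ⟨a, -, -, -, hα₆, hε₀, hδ, hδ7, hκc, ha, hR15, hR16, hR16', hR17, h231,
    ha₂, hκ229, hsm229, habsk, h18half, h18, ha₂', hκ229', hsm229', hR20, ha₅0, habs, hAc, hC3, hAct, hlarge,
    hsmall41, hA₂, hR22, -, -, -, -, -, -, -, -⟩ := hc M (Nat.pos_of_ne_zero (NeZero.ne M))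
  obtain ⟨w, α, rP, hw, hα1, hαs, hsm, hκaw, hlett, hαeq, hReq, hRσeq, hR1, hKθ, hcEj, hgEj, hRe, hPa, hvol⟩ :=
    hsz θ s Rσ₀ a ha
  refine ⟨w, α, rP, hw, hα1, hαs, hlett, hαeq, hReq, hRσeq, ?_⟩
  intro L _ hLc N _ W Uτ hUτ hUtau r hr hr' hsubτ lZ hlZ lD hlD 𝒦 _ _ h𝒦 Γ hlin χY₀ χcP hχ0 hχc0 Dfam Vk hAhol
    hGhol hVholb hχm hχcm hVm hAs w₂₀ qP h222 hqP h220U hw₂₀ hm hfibN hΛ hN H hH hsp E h213 hE0 hE1 W'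
  -- R22: `(1 − 10δ)·½L = 1`, so the closing numerics read at `κ`
  have h22 : (1 - 10 * c.δ) * ((c.L : ℝ) / 2) = 1 := hR22
  have hmul : (1 - 10 * c.δ) * ((c.L : ℝ) / 2) * c.κ = c.κ := by rw [h22, one_mul]
  exact ne5_of_records_symm_late c hL hLc hκ₁ hα₆.ne' N W hθ hs
    (fun j Y => (hτ _ ((tsys 4 (L * N j)).dj_nonneg Y)).1) (fun j Y => (hτ _ ((tsys 4 (L * N j)).dj_nonneg Y)).2)
    hUτ hUtau hr hr' hsubτ lZ hlZ lD hlD 𝒦 hw hα1 hαs h𝒦 Γ hlin χY₀ χcP hχ0 hχc0 Dfam Vk hAhol hGhol hVholb hχm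
    hχcm hVm hAs qP h222 hγ₂.le hqP ha₂₀ h220U hm hfibN hκaw hκb h2 h1 h0 hsm
    (fun j hj Z t φ => hR1 j _ (Nat.cast_nonneg _) (Nat.cast_le.2 (hm j hj Z t φ))) hKθ hcEj hgEj hRe hαc hsmallG hPa
    (fun j hj Z t _ φ _ => hvol j _ _ _ _ (Nat.cast_nonneg _) (Nat.cast_nonneg _) (Nat.cast_nonneg _) (hΛ j hj Z t φ)
      (hN j hj Z t φ) (hw₂₀ j Z))
    hα₆ hε₀ hδ hδ7 hκc ha hR15 hR16 hR16' hR17 h231 ha₂ hκ229 hsm229 habsk h18half h18 ha₂' hκ229' hsm229' hR20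
    ha₅0 habs hAc hC3 hH hsp h213 hE0 hE1 hAct (by rw [hmul]; exact hκc) (by rw [hmul]; exact hlarge)
    (by rw [hmul]; exact hsmall41) hA₂ W'

end Summit.QuantumFields.BalabanUV.T4Continuum.Spine.NE5.TwoRunTorusNE5Final

end
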